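import Summits.Ventures.PercRepro.MSTightLemma

/-!
# Lemma 3 through a tightening direction: an excess-one partner family almost behaves like a
# tight one

Dossier proofs/MINE1-theoremS.md, Addendum 50 supplement 4. p4's Lemma 3 (`subset_of_diffs_mem`,
`exists_subset_of_sdiff_mem`) says that a set all of whose differences against a nonempty TIGHT
family `K` are differences of `K` lies below (resp. above) a member of `K`. For a family `K` of
any excess and an element `e` whose projection `proj e K` is tight — a *tightening direction* of
`K`, which an excess-one family has at every element `e` where its partner family is not tight —
the same hypothesis projected along `e` gives the conclusion up to `e`:
**`t ⊆ insert e k` for some `k ∈ K`** (`exists_subset_insert_of_tight_proj`), because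
`(t ∖ k).erase e = t.erase e ∖ k.erase e` lands in `D(proj e K)`; mirror
`exists_insert_superset_of_tight_proj`. Consequently a member `t` of the `P₁`-eligible set
`B⁺(K) = {t : t \\ K ⊆ D(K)}` that lies below NO member of `K` satisfies `t ∖ k = {e}` for some
`k ∈ K`, for EVERY tightening direction `e` of `K` (`exists_sdiff_eq_singleton_of_not_subset`):
such a `t` contains every tightening direction of `K` and all of them are singleton differences of
`K`. (Census twin on the covering excess-one families of [6], mining/mine-1/g27/proj.c: 389,330
instances of the projection lemma, 0 violations; 4,430 such `t`, all with the singleton form.)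
-/

namespace PercRepro.MSTight

open Finset
open scoped FinsetFamily

variable {α : Type*} [DecidableEq α]

/-- The projection of a difference is a difference of the projection. -/
theorem erase_mem_diffs_proj {K : Finset (Finset α)} {e : α} {w : Finset α}
    (hw : w ∈ K \\ K) : w.erase e ∈ proj e K \\ proj e K := by
  obtain ⟨k₁, hk₁, k₂, hk₂, rfl⟩ := mem_diffs.1 hw
  rw [← erase_sdiff_erase]
  exact mem_diffs.2 ⟨k₁.erase e, mem_proj.2 ⟨k₁, hk₁, rfl⟩, k₂.erase e, mem_proj.2 ⟨k₂, hk₂, rfl⟩,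
    rfl⟩

/-- **Lemma 3 through a tightening direction.** If `proj e K` is tight, `K ≠ ∅`, and every
difference `t ∖ k` (`k ∈ K`) is a difference of `K`, then `t ⊆ insert e k` for some `k ∈ K`. -/
theorem exists_subset_insert_of_tight_proj {K : Finset (Finset α)} {t : Finset α} {e : α}
    (hne : K.Nonempty) (hP : Tight (proj e K)) (ht : ∀ k ∈ K, t \ k ∈ K \\ K) :
    ∃ k ∈ K, t ⊆ insert e k := by
  have hne' : (proj e K).Nonempty := by
    obtain ⟨k, hk⟩ := hne
    exact ⟨k.erase e, mem_proj.2 ⟨k, hk, rfl⟩⟩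
  have hdiff : ∀ E ∈ proj e K, t.erase e \ E ∈ proj e K \\ proj e K := by
    intro E hE
    obtain ⟨k, hk, rfl⟩ := mem_proj.1 hE
    rw [erase_sdiff_erase]
    exact erase_mem_diffs_proj (ht k hk)
  obtain ⟨E, hE, hsub⟩ := subset_of_diffs_mem (K.biUnion id ∪ t) (proj e K) (t.erase e)
    (fun E hE => by
      obtain ⟨k, hk, rfl⟩ := mem_proj.1 hE
      exact (erase_subset e k).trans ((subset_biUnion_of_mem id hk).trans subset_union_left))
    ((erase_subset e t).trans subset_union_right) hne' hP hdiff
  obtain ⟨k, hk, rfl⟩ := mem_proj.1 hE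
  refine ⟨k, hk, ?_⟩
  intro x hx
  by_cases hxe : x = e
  · exact hxe ▸ mem_insert_self e k
  · exact mem_insert_of_mem (mem_of_mem_erase (hsub (mem_erase.2 ⟨hxe, hx⟩)))

/-- **The mirror.** If `proj e K` is tight, `K ≠ ∅`, and every difference `k ∖ s` (`k ∈ K`) is a
difference of `K`, then `k ⊆ insert e s` for some `k ∈ K`. -/
theorem exists_insert_superset_of_tight_proj {K : Finset (Finset α)} {s : Finset α} {e : α}
    (hne : K.Nonempty) (hP : Tight (proj e K)) (hs : ∀ k ∈ K, k \ s ∈ K \\ K) :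
    ∃ k ∈ K, k ⊆ insert e s := by
  have hne' : (proj e K).Nonempty := by
    obtain ⟨k, hk⟩ := hne
    exact ⟨k.erase e, mem_proj.2 ⟨k, hk, rfl⟩⟩
  have hdiff : ∀ E ∈ proj e K, E \ s.erase e ∈ proj e K \\ proj e K := by
    intro E hE
    obtain ⟨k, hk, rfl⟩ := mem_proj.1 hE
    rw [erase_sdiff_erase]
    exact erase_mem_diffs_proj (hs k hk)
  obtain ⟨E, hE, hsub⟩ := exists_subset_of_sdiff_mem (K.biUnion id ∪ s) (proj e K) (s.erase e)
    (fun E hE => by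
      obtain ⟨k, hk, rfl⟩ := mem_proj.1 hE
      exact (erase_subset e k).trans ((subset_biUnion_of_mem id hk).trans subset_union_left))
    ((erase_subset e s).trans subset_union_right) hne' hP hdiff
  obtain ⟨k, hk, rfl⟩ := mem_proj.1 hE
  refine ⟨k, hk, ?_⟩
  intro x hx
  by_cases hxe : x = e
  · exact hxe ▸ mem_insert_self e s
  · exact mem_insert_of_mem (mem_of_mem_erase (hsub (mem_erase.2 ⟨hxe, hx⟩)))

/-- **A `P₁`-eligible set below no member of `K` differs from some member of `K` by exactly the
tightening direction:** `t ∖ k = {e}`. -/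
theorem exists_sdiff_eq_singleton_of_not_subset {K : Finset (Finset α)} {t : Finset α} {e : α}
    (hne : K.Nonempty) (hP : Tight (proj e K)) (ht : ∀ k ∈ K, t \ k ∈ K \\ K)
    (hnot : ∀ k ∈ K, ¬ t ⊆ k) : ∃ k ∈ K, t \ k = {e} := by
  obtain ⟨k, hk, hsub⟩ := exists_subset_insert_of_tight_proj hne hP ht
  refine ⟨k, hk, ?_⟩
  have h1 : t \ k ⊆ {e} := by
    intro x hx
    have hxt := (mem_sdiff.1 hx).1
    have hxk := (mem_sdiff.1 hx).2
    rcases mem_insert.1 (hsub hxt) with h | h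
    · exact mem_singleton.2 h
    · exact absurd h hxk
  have h2 : (t \ k).Nonempty := by
    rw [nonempty_iff_ne_empty]
    intro h
    exact hnot k hk (sdiff_eq_empty_iff_subset.1 h)
  exact (Finset.Nonempty.subset_singleton_iff h2).1 h1

/-- In particular every tightening direction of `K` lies in such a `t`. -/
theorem mem_of_not_subset_of_tight_proj {K : Finset (Finset α)} {t : Finset α} {e : α}
    (hne : K.Nonempty) (hP : Tight (proj e K)) (ht : ∀ k ∈ K, t \ k ∈ K \\ K)
    (hnot : ∀ k ∈ K, ¬ t ⊆ k) : e ∈ t := by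
  obtain ⟨k, -, hk⟩ := exists_sdiff_eq_singleton_of_not_subset hne hP ht hnot
  have : e ∈ t \ k := by
    rw [hk]
    exact mem_singleton_self e
  exact (mem_sdiff.1 this).1

end PercRepro.MSTight
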